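import Summits.ValiantsHypothesis.ValiantsHypothesis.Theorems.KPlusLogSqLawTropicalBMarkedEdgeExchangeFin

/-!
# Route «KPlusLogSqLaw», crux `TropicalB` (stmt-ValiantsHypothesis-19771) — MARKED-EDGE sector, NESTED-TRIANGLE CORE on SIX nodes, part 1: base

HONEST FRAMING.  Helper file (cell `pub-symmetroid`, seat val-sym-trop-p4 (g17), 2026-08-28; `--supports stmt-ValiantsHypothesis-19771 --as
helper`).  First file of the KERNEL version of this seat's located-exact result «the nested-triangle core {1,2},{1,3},{2,3},{0,4} of five marked
bits is not realisable on 6 nodes» (memo LAYER2-CORE-g17.md §2b; certificates exp/logs/cert_m6.log, regenerated independently by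
work/core6/gen/dfs6.py: 177 distinct pair + 292 triple Karamata certificates, 861 leaves).  ABSTRACT SETTING of the four-bit chain
(`…MarkedEdgeExchange`): covers `σ : Equiv.Perm (Fin 6)` (`σ i` = image of node `i`; marked loops = fixed points among 0..4), presence `ok`,
weights `w`, MARKED-EDGE slopes `g i j = if i = j ∧ i < 5 then 2^i else 0` (hypothesis `hg`), unique maximisers at integer parameters.  Nothing
here concerns `TropicalB` in its window, `WeakLifting`, the doors, `MatrixDescartes` (stmt-ValiantsHypothesis-18050) or VP ≠ VNP.
CONTENTS: `theta_lt_of_isMax` (maximisers with smaller slope come at smaller parameters), `monotone_vec2/3`, `slope_Z/C/E/B` (slopes 17, 10,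
12, 6 from the fixed-point patterns), `cases_Z/C/E/B` (the eleven covers of each pattern, by `decide` over the four free values).
-/

set_option linter.dupNamespace false
set_option linter.unusedSimpArgs false
set_option autoImplicit false

namespace Summit.ValiantsHypothesis.ValiantsHypothesis.Theorems.KPlusLogSqLaw
namespace MarkedEdge
namespace CoreSix

open Finset

variable {V : Type*} [Fintype V]

/-- Two unique maximisers (among present covers) with slopes `x < y` at parameters `θ, θ'` satisfy `θ < θ'`. [folklore] -/
theorem theta_lt_of_isMax (ok : V → V → Prop) (w g : V → V → ℤ) {θ θ' : ℤ} {σ τ : Equiv.Perm V}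
    (hσ : (∀ i, ok i (σ i)) ∧ ∀ ρ : Equiv.Perm V, ρ ≠ σ → (∀ i, ok i (ρ i)) →
      ∑ i, (w i (ρ i) + θ * g i (ρ i)) < ∑ i, (w i (σ i) + θ * g i (σ i)))
    (hτ : (∀ i, ok i (τ i)) ∧ ∀ ρ : Equiv.Perm V, ρ ≠ τ → (∀ i, ok i (ρ i)) →
      ∑ i, (w i (ρ i) + θ' * g i (ρ i)) < ∑ i, (w i (τ i) + θ' * g i (τ i)))
    (hlt : (∑ i, g i (σ i)) < ∑ i, g i (τ i)) : θ < θ' := by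
  have hne : τ ≠ σ := by rintro rfl; exact lt_irrefl _ hlt
  have h1 := hσ.2 τ hne hτ.1
  have h2 := hτ.2 σ (Ne.symm hne) hσ.1
  rw [FourBit.score_eq, FourBit.score_eq] at h1 h2
  by_contra hle
  push Not at hle
  nlinarith

/-- Monotonicity of a two-term vector. [folklore] -/
theorem monotone_vec2 {a b : ℤ} (h1 : a ≤ b) : Monotone (![a, b] : Fin 2 → ℤ) := by
  refine Fin.monotone_iff_le_succ.mpr fun i => ?_
  fin_cases i; simp [h1]

/-- Monotonicity of a three-term vector. [folklore] -/
theorem monotone_vec3 {a b c : ℤ} (h1 : a ≤ b) (h2 : b ≤ c) : Monotone (![a, b, c] : Fin 3 → ℤ) := by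
  refine Fin.monotone_iff_le_succ.mpr fun i => ?_
  fin_cases i <;> simp [h1, h2]

/-- The slope of a cover with marked fixed points exactly [0, 4] is 17. [folklore] -/
theorem slope_Z (g : Fin 6 → Fin 6 → ℤ) (hg : ∀ i j : Fin 6, g i j = if i = j ∧ (i : ℕ) < 5 then (2 : ℤ) ^ (i : ℕ) else 0)
    (σ : Equiv.Perm (Fin 6)) (hl0 : σ 0 = 0) (hl4 : σ 4 = 4) (hn1 : σ 1 ≠ 1) (hn2 : σ 2 ≠ 2) (hn3 : σ 3 ≠ 3) : (∑ i, g i (σ i)) = 17 := by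
  simp [hg, Fin.sum_univ_succ, hl0, hl4, Ne.symm hn1, Ne.symm hn2, Ne.symm hn3, eq_comm]

/-- The slope of a cover with marked fixed points exactly [1, 3] is 10. [folklore] -/
theorem slope_C (g : Fin 6 → Fin 6 → ℤ) (hg : ∀ i j : Fin 6, g i j = if i = j ∧ (i : ℕ) < 5 then (2 : ℤ) ^ (i : ℕ) else 0)
    (σ : Equiv.Perm (Fin 6)) (hl1 : σ 1 = 1) (hl3 : σ 3 = 3) (hn0 : σ 0 ≠ 0) (hn2 : σ 2 ≠ 2) (hn4 : σ 4 ≠ 4) : (∑ i, g i (σ i)) = 10 := by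
  simp [hg, Fin.sum_univ_succ, hl1, hl3, Ne.symm hn0, Ne.symm hn2, Ne.symm hn4, eq_comm]

/-- The slope of a cover with marked fixed points exactly [2, 3] is 12. [folklore] -/
theorem slope_E (g : Fin 6 → Fin 6 → ℤ) (hg : ∀ i j : Fin 6, g i j = if i = j ∧ (i : ℕ) < 5 then (2 : ℤ) ^ (i : ℕ) else 0)
    (σ : Equiv.Perm (Fin 6)) (hl2 : σ 2 = 2) (hl3 : σ 3 = 3) (hn0 : σ 0 ≠ 0) (hn1 : σ 1 ≠ 1) (hn4 : σ 4 ≠ 4) : (∑ i, g i (σ i)) = 12 := by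
  simp [hg, Fin.sum_univ_succ, hl2, hl3, Ne.symm hn0, Ne.symm hn1, Ne.symm hn4, eq_comm]

/-- The slope of a cover with marked fixed points exactly [1, 2] is 6. [folklore] -/
theorem slope_B (g : Fin 6 → Fin 6 → ℤ) (hg : ∀ i j : Fin 6, g i j = if i = j ∧ (i : ℕ) < 5 then (2 : ℤ) ^ (i : ℕ) else 0)
    (σ : Equiv.Perm (Fin 6)) (hl1 : σ 1 = 1) (hl2 : σ 2 = 2) (hn0 : σ 0 ≠ 0) (hn3 : σ 3 ≠ 3) (hn4 : σ 4 ≠ 4) : (∑ i, g i (σ i)) = 6 := by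
  simp [hg, Fin.sum_univ_succ, hl1, hl2, Ne.symm hn0, Ne.symm hn3, Ne.symm hn4, eq_comm]

set_option synthInstance.maxSize 4096 in
set_option synthInstance.maxHeartbeats 200000 in
/-- The eleven covers of pattern [0, 4] on six nodes (marked nodes 0..4, node 5 auxiliary): a permutation `σ` of `Fin 6`
fixing exactly the marked nodes [0, 4] takes one of eleven value tuples on the free positions [1, 2, 3, 5]. [folklore; by `decide`] -/
theorem cases_Z (σ : Equiv.Perm (Fin 6)) (hl0 : σ 0 = 0) (hl4 : σ 4 = 4) (hn1 : σ 1 ≠ 1) (hn2 : σ 2 ≠ 2) (hn3 : σ 3 ≠ 3) :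
    (σ 1 = 2 ∧ σ 2 = 1 ∧ σ 3 = 5 ∧ σ 5 = 3) ∨
    (σ 1 = 2 ∧ σ 2 = 3 ∧ σ 3 = 1 ∧ σ 5 = 5) ∨
    (σ 1 = 2 ∧ σ 2 = 3 ∧ σ 3 = 5 ∧ σ 5 = 1) ∨
    (σ 1 = 2 ∧ σ 2 = 5 ∧ σ 3 = 1 ∧ σ 5 = 3) ∨
    (σ 1 = 3 ∧ σ 2 = 1 ∧ σ 3 = 2 ∧ σ 5 = 5) ∨
    (σ 1 = 3 ∧ σ 2 = 1 ∧ σ 3 = 5 ∧ σ 5 = 2) ∨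
    (σ 1 = 3 ∧ σ 2 = 5 ∧ σ 3 = 1 ∧ σ 5 = 2) ∨
    (σ 1 = 3 ∧ σ 2 = 5 ∧ σ 3 = 2 ∧ σ 5 = 1) ∨
    (σ 1 = 5 ∧ σ 2 = 1 ∧ σ 3 = 2 ∧ σ 5 = 3) ∨
    (σ 1 = 5 ∧ σ 2 = 3 ∧ σ 3 = 1 ∧ σ 5 = 2) ∨
    (σ 1 = 5 ∧ σ 2 = 3 ∧ σ 3 = 2 ∧ σ 5 = 1) := by
  have key : ∀ a b c d : Fin 6, (a ≠ 0 ∧ a ≠ 4 ∧ a ≠ 1) → (b ≠ 0 ∧ b ≠ 4 ∧ b ≠ 2) → (c ≠ 0 ∧ c ≠ 4 ∧ c ≠ 3) → (d ≠ 0 ∧ d ≠ 4) → (a ≠ b ∧ a ≠ c ∧ a ≠ d ∧ b ≠ c ∧ b ≠ d ∧ c ≠ d) →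
      (a = 2 ∧ b = 1 ∧ c = 5 ∧ d = 3) ∨ (a = 2 ∧ b = 3 ∧ c = 1 ∧ d = 5) ∨ (a = 2 ∧ b = 3 ∧ c = 5 ∧ d = 1) ∨ (a = 2 ∧ b = 5 ∧ c = 1 ∧ d = 3) ∨ (a = 3 ∧ b = 1 ∧ c = 2 ∧ d = 5) ∨ (a = 3 ∧ b = 1 ∧ c = 5 ∧ d = 2) ∨ (a = 3 ∧ b = 5 ∧ c = 1 ∧ d = 2) ∨ (a = 3 ∧ b = 5 ∧ c = 2 ∧ d = 1) ∨ (a = 5 ∧ b = 1 ∧ c = 2 ∧ d = 3) ∨ (a = 5 ∧ b = 3 ∧ c = 1 ∧ d = 2) ∨ (a = 5 ∧ b = 3 ∧ c = 2 ∧ d = 1) := by decide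
  exact key (σ 1) (σ 2) (σ 3) (σ 5) ⟨fun h => absurd (σ.injective (h.trans hl0.symm)) (by decide), fun h => absurd (σ.injective (h.trans hl4.symm)) (by decide), hn1⟩ ⟨fun h => absurd (σ.injective (h.trans hl0.symm)) (by decide), fun h => absurd (σ.injective (h.trans hl4.symm)) (by decide), hn2⟩ ⟨fun h => absurd (σ.injective (h.trans hl0.symm)) (by decide), fun h => absurd (σ.injective (h.trans hl4.symm)) (by decide), hn3⟩ ⟨fun h => absurd (σ.injective (h.trans hl0.symm)) (by decide), fun h => absurd (σ.injective (h.trans hl4.symm)) (by decide)⟩ ⟨fun h => absurd (σ.injective h) (by decide), fun h => absurd (σ.injective h) (by decide), fun h => absurd (σ.injective h) (by decide), fun h => absurd (σ.injective h) (by decide), fun h => absurd (σ.injective h) (by decide), fun h => absurd (σ.injective h) (by decide)⟩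

set_option synthInstance.maxSize 4096 in
set_option synthInstance.maxHeartbeats 200000 in
/-- The eleven covers of pattern [1, 3] on six nodes (marked nodes 0..4, node 5 auxiliary): a permutation `σ` of `Fin 6`
fixing exactly the marked nodes [1, 3] takes one of eleven value tuples on the free positions [0, 2, 4, 5]. [folklore; by `decide`] -/
theorem cases_C (σ : Equiv.Perm (Fin 6)) (hl1 : σ 1 = 1) (hl3 : σ 3 = 3) (hn0 : σ 0 ≠ 0) (hn2 : σ 2 ≠ 2) (hn4 : σ 4 ≠ 4) :
    (σ 0 = 2 ∧ σ 2 = 0 ∧ σ 4 = 5 ∧ σ 5 = 4) ∨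
    (σ 0 = 2 ∧ σ 2 = 4 ∧ σ 4 = 0 ∧ σ 5 = 5) ∨
    (σ 0 = 2 ∧ σ 2 = 4 ∧ σ 4 = 5 ∧ σ 5 = 0) ∨
    (σ 0 = 2 ∧ σ 2 = 5 ∧ σ 4 = 0 ∧ σ 5 = 4) ∨
    (σ 0 = 4 ∧ σ 2 = 0 ∧ σ 4 = 2 ∧ σ 5 = 5) ∨
    (σ 0 = 4 ∧ σ 2 = 0 ∧ σ 4 = 5 ∧ σ 5 = 2) ∨
    (σ 0 = 4 ∧ σ 2 = 5 ∧ σ 4 = 0 ∧ σ 5 = 2) ∨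
    (σ 0 = 4 ∧ σ 2 = 5 ∧ σ 4 = 2 ∧ σ 5 = 0) ∨
    (σ 0 = 5 ∧ σ 2 = 0 ∧ σ 4 = 2 ∧ σ 5 = 4) ∨
    (σ 0 = 5 ∧ σ 2 = 4 ∧ σ 4 = 0 ∧ σ 5 = 2) ∨
    (σ 0 = 5 ∧ σ 2 = 4 ∧ σ 4 = 2 ∧ σ 5 = 0) := by
  have key : ∀ a b c d : Fin 6, (a ≠ 1 ∧ a ≠ 3 ∧ a ≠ 0) → (b ≠ 1 ∧ b ≠ 3 ∧ b ≠ 2) → (c ≠ 1 ∧ c ≠ 3 ∧ c ≠ 4) → (d ≠ 1 ∧ d ≠ 3) → (a ≠ b ∧ a ≠ c ∧ a ≠ d ∧ b ≠ c ∧ b ≠ d ∧ c ≠ d) →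
      (a = 2 ∧ b = 0 ∧ c = 5 ∧ d = 4) ∨ (a = 2 ∧ b = 4 ∧ c = 0 ∧ d = 5) ∨ (a = 2 ∧ b = 4 ∧ c = 5 ∧ d = 0) ∨ (a = 2 ∧ b = 5 ∧ c = 0 ∧ d = 4) ∨ (a = 4 ∧ b = 0 ∧ c = 2 ∧ d = 5) ∨ (a = 4 ∧ b = 0 ∧ c = 5 ∧ d = 2) ∨ (a = 4 ∧ b = 5 ∧ c = 0 ∧ d = 2) ∨ (a = 4 ∧ b = 5 ∧ c = 2 ∧ d = 0) ∨ (a = 5 ∧ b = 0 ∧ c = 2 ∧ d = 4) ∨ (a = 5 ∧ b = 4 ∧ c = 0 ∧ d = 2) ∨ (a = 5 ∧ b = 4 ∧ c = 2 ∧ d = 0) := by decide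
  exact key (σ 0) (σ 2) (σ 4) (σ 5) ⟨fun h => absurd (σ.injective (h.trans hl1.symm)) (by decide), fun h => absurd (σ.injective (h.trans hl3.symm)) (by decide), hn0⟩ ⟨fun h => absurd (σ.injective (h.trans hl1.symm)) (by decide), fun h => absurd (σ.injective (h.trans hl3.symm)) (by decide), hn2⟩ ⟨fun h => absurd (σ.injective (h.trans hl1.symm)) (by decide), fun h => absurd (σ.injective (h.trans hl3.symm)) (by decide), hn4⟩ ⟨fun h => absurd (σ.injective (h.trans hl1.symm)) (by decide), fun h => absurd (σ.injective (h.trans hl3.symm)) (by decide)⟩ ⟨fun h => absurd (σ.injective h) (by decide), fun h => absurd (σ.injective h) (by decide), fun h => absurd (σ.injective h) (by decide), fun h => absurd (σ.injective h) (by decide), fun h => absurd (σ.injective h) (by decide), fun h => absurd (σ.injective h) (by decide)⟩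

set_option synthInstance.maxSize 4096 in
set_option synthInstance.maxHeartbeats 200000 in
/-- The eleven covers of pattern [2, 3] on six nodes (marked nodes 0..4, node 5 auxiliary): a permutation `σ` of `Fin 6`
fixing exactly the marked nodes [2, 3] takes one of eleven value tuples on the free positions [0, 1, 4, 5]. [folklore; by `decide`] -/
theorem cases_E (σ : Equiv.Perm (Fin 6)) (hl2 : σ 2 = 2) (hl3 : σ 3 = 3) (hn0 : σ 0 ≠ 0) (hn1 : σ 1 ≠ 1) (hn4 : σ 4 ≠ 4) :
    (σ 0 = 1 ∧ σ 1 = 0 ∧ σ 4 = 5 ∧ σ 5 = 4) ∨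
    (σ 0 = 1 ∧ σ 1 = 4 ∧ σ 4 = 0 ∧ σ 5 = 5) ∨
    (σ 0 = 1 ∧ σ 1 = 4 ∧ σ 4 = 5 ∧ σ 5 = 0) ∨
    (σ 0 = 1 ∧ σ 1 = 5 ∧ σ 4 = 0 ∧ σ 5 = 4) ∨
    (σ 0 = 4 ∧ σ 1 = 0 ∧ σ 4 = 1 ∧ σ 5 = 5) ∨
    (σ 0 = 4 ∧ σ 1 = 0 ∧ σ 4 = 5 ∧ σ 5 = 1) ∨
    (σ 0 = 4 ∧ σ 1 = 5 ∧ σ 4 = 0 ∧ σ 5 = 1) ∨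
    (σ 0 = 4 ∧ σ 1 = 5 ∧ σ 4 = 1 ∧ σ 5 = 0) ∨
    (σ 0 = 5 ∧ σ 1 = 0 ∧ σ 4 = 1 ∧ σ 5 = 4) ∨
    (σ 0 = 5 ∧ σ 1 = 4 ∧ σ 4 = 0 ∧ σ 5 = 1) ∨
    (σ 0 = 5 ∧ σ 1 = 4 ∧ σ 4 = 1 ∧ σ 5 = 0) := by
  have key : ∀ a b c d : Fin 6, (a ≠ 2 ∧ a ≠ 3 ∧ a ≠ 0) → (b ≠ 2 ∧ b ≠ 3 ∧ b ≠ 1) → (c ≠ 2 ∧ c ≠ 3 ∧ c ≠ 4) → (d ≠ 2 ∧ d ≠ 3) → (a ≠ b ∧ a ≠ c ∧ a ≠ d ∧ b ≠ c ∧ b ≠ d ∧ c ≠ d) →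
      (a = 1 ∧ b = 0 ∧ c = 5 ∧ d = 4) ∨ (a = 1 ∧ b = 4 ∧ c = 0 ∧ d = 5) ∨ (a = 1 ∧ b = 4 ∧ c = 5 ∧ d = 0) ∨ (a = 1 ∧ b = 5 ∧ c = 0 ∧ d = 4) ∨ (a = 4 ∧ b = 0 ∧ c = 1 ∧ d = 5) ∨ (a = 4 ∧ b = 0 ∧ c = 5 ∧ d = 1) ∨ (a = 4 ∧ b = 5 ∧ c = 0 ∧ d = 1) ∨ (a = 4 ∧ b = 5 ∧ c = 1 ∧ d = 0) ∨ (a = 5 ∧ b = 0 ∧ c = 1 ∧ d = 4) ∨ (a = 5 ∧ b = 4 ∧ c = 0 ∧ d = 1) ∨ (a = 5 ∧ b = 4 ∧ c = 1 ∧ d = 0) := by decide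
  exact key (σ 0) (σ 1) (σ 4) (σ 5) ⟨fun h => absurd (σ.injective (h.trans hl2.symm)) (by decide), fun h => absurd (σ.injective (h.trans hl3.symm)) (by decide), hn0⟩ ⟨fun h => absurd (σ.injective (h.trans hl2.symm)) (by decide), fun h => absurd (σ.injective (h.trans hl3.symm)) (by decide), hn1⟩ ⟨fun h => absurd (σ.injective (h.trans hl2.symm)) (by decide), fun h => absurd (σ.injective (h.trans hl3.symm)) (by decide), hn4⟩ ⟨fun h => absurd (σ.injective (h.trans hl2.symm)) (by decide), fun h => absurd (σ.injective (h.trans hl3.symm)) (by decide)⟩ ⟨fun h => absurd (σ.injective h) (by decide), fun h => absurd (σ.injective h) (by decide), fun h => absurd (σ.injective h) (by decide), fun h => absurd (σ.injective h) (by decide), fun h => absurd (σ.injective h) (by decide), fun h => absurd (σ.injective h) (by decide)⟩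

set_option synthInstance.maxSize 4096 in
set_option synthInstance.maxHeartbeats 200000 in
/-- The eleven covers of pattern [1, 2] on six nodes (marked nodes 0..4, node 5 auxiliary): a permutation `σ` of `Fin 6`
fixing exactly the marked nodes [1, 2] takes one of eleven value tuples on the free positions [0, 3, 4, 5]. [folklore; by `decide`] -/
theorem cases_B (σ : Equiv.Perm (Fin 6)) (hl1 : σ 1 = 1) (hl2 : σ 2 = 2) (hn0 : σ 0 ≠ 0) (hn3 : σ 3 ≠ 3) (hn4 : σ 4 ≠ 4) :
    (σ 0 = 3 ∧ σ 3 = 0 ∧ σ 4 = 5 ∧ σ 5 = 4) ∨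
    (σ 0 = 3 ∧ σ 3 = 4 ∧ σ 4 = 0 ∧ σ 5 = 5) ∨
    (σ 0 = 3 ∧ σ 3 = 4 ∧ σ 4 = 5 ∧ σ 5 = 0) ∨
    (σ 0 = 3 ∧ σ 3 = 5 ∧ σ 4 = 0 ∧ σ 5 = 4) ∨
    (σ 0 = 4 ∧ σ 3 = 0 ∧ σ 4 = 3 ∧ σ 5 = 5) ∨
    (σ 0 = 4 ∧ σ 3 = 0 ∧ σ 4 = 5 ∧ σ 5 = 3) ∨
    (σ 0 = 4 ∧ σ 3 = 5 ∧ σ 4 = 0 ∧ σ 5 = 3) ∨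
    (σ 0 = 4 ∧ σ 3 = 5 ∧ σ 4 = 3 ∧ σ 5 = 0) ∨
    (σ 0 = 5 ∧ σ 3 = 0 ∧ σ 4 = 3 ∧ σ 5 = 4) ∨
    (σ 0 = 5 ∧ σ 3 = 4 ∧ σ 4 = 0 ∧ σ 5 = 3) ∨
    (σ 0 = 5 ∧ σ 3 = 4 ∧ σ 4 = 3 ∧ σ 5 = 0) := by
  have key : ∀ a b c d : Fin 6, (a ≠ 1 ∧ a ≠ 2 ∧ a ≠ 0) → (b ≠ 1 ∧ b ≠ 2 ∧ b ≠ 3) → (c ≠ 1 ∧ c ≠ 2 ∧ c ≠ 4) → (d ≠ 1 ∧ d ≠ 2) → (a ≠ b ∧ a ≠ c ∧ a ≠ d ∧ b ≠ c ∧ b ≠ d ∧ c ≠ d) →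
      (a = 3 ∧ b = 0 ∧ c = 5 ∧ d = 4) ∨ (a = 3 ∧ b = 4 ∧ c = 0 ∧ d = 5) ∨ (a = 3 ∧ b = 4 ∧ c = 5 ∧ d = 0) ∨ (a = 3 ∧ b = 5 ∧ c = 0 ∧ d = 4) ∨ (a = 4 ∧ b = 0 ∧ c = 3 ∧ d = 5) ∨ (a = 4 ∧ b = 0 ∧ c = 5 ∧ d = 3) ∨ (a = 4 ∧ b = 5 ∧ c = 0 ∧ d = 3) ∨ (a = 4 ∧ b = 5 ∧ c = 3 ∧ d = 0) ∨ (a = 5 ∧ b = 0 ∧ c = 3 ∧ d = 4) ∨ (a = 5 ∧ b = 4 ∧ c = 0 ∧ d = 3) ∨ (a = 5 ∧ b = 4 ∧ c = 3 ∧ d = 0) := by decide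
  exact key (σ 0) (σ 3) (σ 4) (σ 5) ⟨fun h => absurd (σ.injective (h.trans hl1.symm)) (by decide), fun h => absurd (σ.injective (h.trans hl2.symm)) (by decide), hn0⟩ ⟨fun h => absurd (σ.injective (h.trans hl1.symm)) (by decide), fun h => absurd (σ.injective (h.trans hl2.symm)) (by decide), hn3⟩ ⟨fun h => absurd (σ.injective (h.trans hl1.symm)) (by decide), fun h => absurd (σ.injective (h.trans hl2.symm)) (by decide), hn4⟩ ⟨fun h => absurd (σ.injective (h.trans hl1.symm)) (by decide), fun h => absurd (σ.injective (h.trans hl2.symm)) (by decide)⟩ ⟨fun h => absurd (σ.injective h) (by decide), fun h => absurd (σ.injective h) (by decide), fun h => absurd (σ.injective h) (by decide), fun h => absurd (σ.injective h) (by decide), fun h => absurd (σ.injective h) (by decide), fun h => absurd (σ.injective h) (by decide)⟩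


end CoreSix
end MarkedEdge
end Summit.ValiantsHypothesis.ValiantsHypothesis.Theorems.KPlusLogSqLaw
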